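import Literature.MathematicalPhysics.QuantumFieldTheory.Balaban1983to89.Node00.TkNoExpansionStepSucc
import Literature.MathematicalPhysics.QuantumFieldTheory.Balaban1983to89.Node00.Record13

/-!
# NODE 00 — THE NO-EXPANSION 𝐓-STEPS OF RECORD RE-KEYED AT THE STAGE-13 RECORD: N11's residue (S1ᵀ)₁₃ at the all-large-field new
# sequences (`Ω_{k+1}(s′) = ∅`) as EXPLICIT TRANSPORT EQUATIONS along the Stage-13 history `gOfRecord₁₃`, weights `WtOfRecord₁₃`, setting
# `settingOfRecord₁₃` and background maps `UbgOfRecord₁₃` — the `₁₃` twins of the record-keyed sections of `TkNoExpansionStepZero` §4–§5 and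
# `TkNoExpansionStepSucc` §3, §5 (their generic sections §1–§3 ∕ §1–§2, §4 are cited BY NAME, never restated)

Cell `pub-ymgap`, YM-PLAN Track A (HUMAN RULING D-0062); author seat `pub-ymgap-dag-n11-d` (g4; R134 fan-out seat N11 [B14], strategy s2), lineage item K1′
`StabilityBAtRecordR12e` = stmt-QuantumFields-19903 → K1‴ `StabilityBAtRecordR13e` at the route's rev 16 (director-ym LINE №125 (3): every ₁₂ module re-keys
BY NAME at `Node00/Record13`).  [III] = [Balaban1988Convergent], [I] = [Balaban1987RG1], [6] = [Balaban1985RegularSpaces], [15] = [Balaban1985Variational].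

WHY.  NODE 00's Stage 13 (`Record13`, seat node00-def-T, FILE 13 v1.1) re-instantiates every history-keyed object of record along the NEW generated history
`gOfRecord₁₃ θ p = genSeq β₁₃ g₀` (β read through K0e's canonical-version transport and the (2.9) species): the 𝐓-weights `WtOfRecord₁₃`, the §2 setting
`settingOfRecord₁₃`, the background maps `UbgOfRecord₁₃`, the repaired format laws `SLaw₁₃` ∕ `TLaw₁₃`; no implication between the Stage-12 and Stage-13 laws
holds letter for letter (Record13 (μ)).  Node N11's residue at a Stage-13 record is (S1ᵀ)₁₃ «`∀ k < K, SLaw₁₃ θ P k → TLaw₁₃ θ P k`» (this seat's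
`BalabanUVNodesN11AtRecord13C`); the located content this seat extracted from (S1ᵀ) at Stage 12 — what it DEMANDS of a witness's residual 𝐓-weights `θ.Zt` on
the NO-EXPANSION histories, where print performs no background-field expansion and creates no new terms ((2.22) p. 258) — is RE-KEYED here so that the
K0‴ ∕ K1‴ witness builders read it at the objects they actually use.  Every proof is the Stage-12 proof with the generic lemma of `TkNoExpansionStepZero` ∕
`TkNoExpansionStepSucc` ∕ `TkFullBondTransport` cited by name and the record letters `₁₂ ↦ ₁₃`; nothing new is claimed about the generic layer.

WHAT THIS FILE PROVES (0 `sorry`, 0 `def`, 0 `instance`, 0 `notation`; `N`-generic; `θ : Stage13Params F N` arbitrary, run `p`).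
§1 LEVEL 1 (`s′ : SeqOfRecord … (gOfRecord₁₃ θ p) p.K 1`, `s′.Ω 1 = ∅`): `WtOfRecord₁₃_eq` (`rfl`); `noExpIntegrand_WtOfRecord₁₃_sect2Operand` (the no-expansion
   integrand at the ₁₃ weights and the §2 operand, explicit: `ζ0_0(T)·χreg_0(T)·e^{−½quad_0(∅)}·exp A_1(s′)(U_1(𝐖))` at the two-scale configuration);
   `sect2Slot_one_eq_kernelRT_of_Omega_empty₁₃` (pointwise) ∕ `sect2Slot_one_ae_eq_transport_of_Omega_empty₁₃` (a.e., displayed measurability ∕ bound, `0 < K`);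
   **`tLaw₁₃_zero_clause_of_Omega_empty`** (`TLaw₁₃ θ p 0` ⇒ at `s′` the GUARD-FREE dichotomy «`slotT_1(s′) = 0` or `slotT_1(s′) = 𝐓_1(s′)e^{A_1(s′)}`
   `dV₁`-a.e.»); **`tLaw₁₃_zero_coherence_of_Omega_empty`** (THE LEVEL-1 NO-EXPANSION COHERENCE EQUATION at Stage 13: either `slotT_1(s′) ≡ 0` or
   `∫dU δ(ŪV₁⁻¹) w(s′)(U,V₁)·ρ₀(U) = ∫dU δ(ŪV₁⁻¹) ζ0_0(T)·χreg_0(T)·e^{−½quad_0(∅)}·exp A_1(s′)(U_1) (U,V₁)` a.e.);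
   **`slotsT_one_ae_eq_sect2Slot_of_fibre_identity₁₃`** ∕ `hasSect2FormAtZ_clause_one_of_fibre_identity₁₃` (SUFFICIENCY for a witness builder: the fibre identity
   of integrands discharges the identity branch at `s′`).
§2 THE BACKGROUND OF RECORD AT THE ALL-LARGE-FIELD SEQUENCE, Stage 13: `UbgOfRecord₁₃_one_of_Omega_empty` (`U_1(s′)(𝐖) = 𝐖 0` for `ε₀`-regular `𝐖 0`) ∕
   `…_of_not` (junk `1` otherwise) ∕ `UbgOfRecord₁₃_one_pairCfg_of_Omega_empty`; `noExpIntegrand_WtOfRecord₁₃_sect2Operand_of_regular` ∕ `…_of_chiRegW_ne_zero`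
   (the right-hand integrand with the background RESOLVED under the letters' junction `cR·ε₀ ≤ ε₀^{reg}·η₀²` along `gOfRecord₁₃`),
   `noExpIntegrand_WtOfRecord₁₃_eq_zero_of_chiRegW_eq_zero`; `UbgOfRecord₁₃_succ_eq_init_of_Omega_empty` (`k ≥ 1`: unchanged along a no-expansion step) ∕
   `UbgOfRecord₁₃_one_eq_init_of_Omega_empty` (`k = 0`, on print's class).
§3 LEVEL k+1 (`s′ : SeqOfRecord … (gOfRecord₁₃ θ p) p.K (k+1)`, `s′.Ω (k+1) = ∅`, `k < K`): **`slotsTOfRecord_succ_of_sLaw₁₃`** (under `SLaw₁₃ θ p k` the pre-𝐑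
   slot at level `k+1` is the transport of `w(s′)·χ_k·𝐓_k(init s′)e^{A_k(init s′)}`, or zero); `sect2Slot_succ_eq_sum_kernelRT_of_Omega_empty₁₃` ∕
   `sect2Slot_succ_ae_eq_sum_transport_of_Omega_empty₁₃`; **`tLaw₁₃_clause_of_Omega_empty`**; **`tLaw₁₃_coherence_of_Omega_empty`** (THE LEVEL-(k+1) COHERENCE
   EQUATION at Stage 13: either `slotT_{k+1}(s′) ≡ 0` or, a.e.,
   `∫dU δ(ŪV′⁻¹) w(s′)χ_k(init s′)𝐓_k(init s′)e^{A_k(init s′)} = Σ_S ∫dU δ(ŪV′⁻¹) ζ0_k(T)χreg_k(T)e^{−½quad_k(∅)}[𝐓_k(init s′,S)e^{A_{k+1}(s′)}_S]`).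

HONEST SCOPE.  Kernel bookkeeping on the tree's OWN objects — a BY-NAME RE-KEY of landed theorems (p481649 · p485389) at the Stage-13 record; every identity
is PROVED by unfolding, the measure-theoretic faces from displayed hypotheses.  Nothing of Bałaban's is asserted: Theorem p. 245, Thms 1–2 [III], (3.6)–(3.25),
[6], [15] Thm 1 are what would make the displayed equations TRUE at the objects of a correct witness.  This file never reads the record's `bg` proviso nor the
letter `ε₂₉`.  N11 is NOT discharged; no node count moves (typed 28∕28 · discharged 5∕28).  One finite four-torus programme at fixed `ε = L^{−K}`, Bałaban AS
PRINTED with locators; NOT ℝ⁴, NOT infinite volume, NOT OS, NOT a mass gap, NOT the Clay problem.  Sources: [III] (2.2) p. 255, (2.10)–(2.13) pp. 256–257,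
(2.17)–(2.18) p. 257, (2.21)–(2.23) p. 258, Thm 1 p. 262, (3.1) p. 264, (3.24)–(3.25) p. 270, Theorem p. 245; [I] (2.9) p. 266 (the ₁₃ β-layer species);
[6] (1.7) p. 77; [15] Thm 1 (8) p. 279.
-/

noncomputable section

open MeasureTheory
open scoped Matrix.Norms.L2Operator

namespace Literature.MathematicalPhysics.QuantumFieldTheory.Balaban1983to89.Node00

open T4AveragingDisintegration T4Continuum T4FiniteEpsInhabited Tk B14.Eq218Concrete
open B15DeterminingSets

variable {F : T4Family} {N : ℕ} [NeZero N]

/-! ## §1  LEVEL 1 at the Stage-13 record: the §2-form slot at the all-large-field sequence; (S1ᵀ)₁₃,₀ there as a transport equation -/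

section LevelOne

variable (θ : Stage13Params F N) (p : B12.RunParams)

/-- The Stage-13 𝐓-weights of record of the run ARE 12a's weights at the run's letters along `gOfRecord₁₃` (`rfl`). [cite: Balaban1988Convergent, (2.21) p.258 (bookkeeping)] -/
theorem WtOfRecord₁₃_eq : WtOfRecord₁₃ F N θ p =
    tkWeightsOfRecord F N (FluctV N) θ.ν θ.A₁ θ.s2.cR p (gOfRecord₁₃ F N θ p) (θ.Zt p.K) := rfl

/-- **THE NO-EXPANSION INTEGRAND AT THE STAGE-13 RECORD, EXPLICIT**: at the ₁₃ 𝐓-weights of record and the §2 operand `exp A_1(s′)` it reads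
`ζ0_0(T)·χreg_0(T)·e^{−½ quad_0(∅)}·exp A_1(s′)(U_1(𝐖))` at the two-scale configuration `𝐖 = (U, V₁)` (fluctuation fields `0`).
[cite: Balaban1988Convergent, (2.18) p.257, (2.21)–(2.23) p.258, (2.10) p.256] -/
theorem noExpIntegrand_WtOfRecord₁₃_sect2Operand (s : SeqOfRecord F θ.ν θ.τ9.M (gOfRecord₁₃ F N θ p) p.K 1)
    (t : Sect2.TermValues (F.P p.K) (MatA N) (FluctV N) θ.τ9.M) (Ek : ℝ) (U : BgMap F N p.K) (V1 : GaugeField (F.P p.K) 1 (SU N))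
    (Uf : GaugeField (F.P p.K) 0 (SU N)) :
    noExpIntegrand F N (FluctV N) p.K (WtOfRecord₁₃ F N θ p)
        (sect2Operand F N (FluctV N) p.K (settingOfRecord₁₃ F N θ p) (θ.Rz p.K) s t Ek U) V1 Uf =
      (θ.Zt p.K).ζ0 0 Set.univ (pairCfg V1 Uf) *
          chiRegW F N (FluctV N) θ.ν θ.s2.cR p (gOfRecord₁₃ F N θ p) 0 Set.univ (pairCfg V1 Uf) *
        (Real.exp (-(1 / 2 : ℝ) * (θ.Zt p.K).quad 0 ∅ (pairCfg V1 Uf)) *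
          Real.exp ((sect2ActionDataOfRecord F N (FluctV N) p.K (settingOfRecord₁₃ F N θ p) (θ.Rz p.K) s t
            (fun _ => ∅, fun j => (pairCfg (V := FluctV N) V1 Uf j).2) Ek).action23 1 (U fun j => (pairCfg (V := FluctV N) V1 Uf j).1))) :=
  noExpIntegrand_tkWeightsOfRecord (θ.Zt p.K) _ V1 Uf

/-- **THE §2-FORM SLOT `𝐓_1(s′) exp A_1(s′)` OF RECORD (Stage 13) AT THE ALL-LARGE-FIELD SEQUENCE, UNFOLDED POINTWISE**: one restricted kernel transport of
record on the full bond sets of the explicit no-expansion integrand (`TkOfRecord_one_eq_kernelRT_of_Omega_empty` along `gOfRecord₁₃`).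
[cite: Balaban1988Convergent, (2.18) p.257, (2.21)–(2.23) p.258, (3.24) p.270] -/
theorem sect2Slot_one_eq_kernelRT_of_Omega_empty₁₃ (s : SeqOfRecord F θ.ν θ.τ9.M (gOfRecord₁₃ F N θ p) p.K 1) (hΩ : s.Ω 1 = ∅)
    (t : Sect2.TermValues (F.P p.K) (MatA N) (FluctV N) θ.τ9.M) (Ek : ℝ) (U : BgMap F N p.K) (V1 : GaugeField (F.P p.K) 1 (SU N))
    {hdec : DecidableEq (PBond (F.P p.K) 0)} :
    sect2Slot F N (FluctV N) p.K (settingOfRecord₁₃ F N θ p) (θ.Rz p.K) (WtOfRecord₁₃ F N θ p) s t Ek U V1 =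
      kernelRTOfRecord F N p.K 0 (genDataOfRecord F N (FluctV N) θ.ν θ.τ9.M _ p.K (WtOfRecord₁₃ F N θ p) s (fun _ => ∅) 0).sV
        (genDataOfRecord F N (FluctV N) θ.ν θ.τ9.M _ p.K (WtOfRecord₁₃ F N θ p) s (fun _ => ∅) 0).sV'
        (fun y => noExpIntegrand F N (FluctV N) p.K (WtOfRecord₁₃ F N θ p)
          (sect2Operand F N (FluctV N) p.K (settingOfRecord₁₃ F N θ p) (θ.Rz p.K) s t Ek U) V1
          (Function.updateFinset (fun _ => 1) (genDataOfRecord F N (FluctV N) θ.ν θ.τ9.M _ p.K (WtOfRecord₁₃ F N θ p) s (fun _ => ∅) 0).sV y))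
        (fun b => V1 b) :=
  TkOfRecord_one_eq_kernelRT_of_Omega_empty θ.ν θ.τ9.M _ p.K (WtOfRecord₁₃ F N θ p) s hΩ _ V1

/-- **… AND ALMOST EVERYWHERE AS def-T's TRANSPORT OF RECORD** (`0 < K`; the integrand family jointly measurable and bounded — displayed).
[cite: Balaban1988Convergent, (2.18) p.257, (3.1) p.264, (3.25) p.270] -/
theorem sect2Slot_one_ae_eq_transport_of_Omega_empty₁₃ (hK : 0 < p.K)
    (s : SeqOfRecord F θ.ν θ.τ9.M (gOfRecord₁₃ F N θ p) p.K 1) (hΩ : s.Ω 1 = ∅)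
    (t : Sect2.TermValues (F.P p.K) (MatA N) (FluctV N) θ.τ9.M) (Ek : ℝ) (U : BgMap F N p.K) {C : ℝ}
    (hm : Measurable (Function.uncurry (noExpIntegrand F N (FluctV N) p.K (WtOfRecord₁₃ F N θ p)
      (sect2Operand F N (FluctV N) p.K (settingOfRecord₁₃ F N θ p) (θ.Rz p.K) s t Ek U))))
    (hC : ∀ V1 Uf, |noExpIntegrand F N (FluctV N) p.K (WtOfRecord₁₃ F N θ p)
      (sect2Operand F N (FluctV N) p.K (settingOfRecord₁₃ F N θ p) (θ.Rz p.K) s t Ek U) V1 Uf| ≤ C) :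
    sect2Slot F N (FluctV N) p.K (settingOfRecord₁₃ F N θ p) (θ.Rz p.K) (WtOfRecord₁₃ F N θ p) s t Ek U =ᵐ[fieldMeasure (F.P p.K) 1 (SU N)]
      fun V1 => transportOfRecord F N p.K 0 (noExpIntegrand F N (FluctV N) p.K (WtOfRecord₁₃ F N θ p)
        (sect2Operand F N (FluctV N) p.K (settingOfRecord₁₃ F N θ p) (θ.Rz p.K) s t Ek U) V1) V1 :=
  TkOfRecord_one_ae_eq_transportOfRecord_of_Omega_empty θ.ν θ.τ9.M _ hK (WtOfRecord₁₃ F N θ p) s hΩ _ hm hC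

/-- **THE (S1ᵀ)₁₃,₀ CLAUSE AT THE ALL-LARGE-FIELD SEQUENCE**: if `TLaw₁₃ θ p 0` holds, its witness `(t, E_1)` (universal 𝐄-terms, `LawsT … 0` on every new
sequence) satisfies at `s′` with `Ω₁(s′) = ∅` the GUARD-FREE dichotomy «`slotT_1(s′)` is the zero function, or `slotT_1(s′)(V₁) = 𝐓_1(s′) exp A_1(s′) (V₁)` for
`dV₁`-a.e. `V₁`» — the front factor `χ_1(s′) ≡ 1` there, so the (3.25) identity is demanded almost everywhere. [cite: Balaban1988Convergent, (3.25) p.270, remark p.262, Theorem p.245] -/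
theorem tLaw₁₃_zero_clause_of_Omega_empty (hT : TLaw₁₃ F N θ p 0)
    (s : SeqOfRecord F θ.ν θ.τ9.M (gOfRecord₁₃ F N θ p) p.K 1) (hΩ : s.Ω 1 = ∅) :
    ∃ (t : SeqOfRecord F θ.ν θ.τ9.M (gOfRecord₁₃ F N θ p) p.K 1 → Sect2.TermValues (F.P p.K) (MatA N) (FluctV N) θ.τ9.M)
      (Ek : SeqOfRecord F θ.ν θ.τ9.M (gOfRecord₁₃ F N θ p) p.K 1 → ℝ),
      Sect2.UniversalE t ∧
      (∀ s', Sect2.LawsT (sect2TowerOfRecord F N (FluctV N) p.K (settingOfRecord₁₃ F N θ p) (θ.Rz p.K) s' (t s'))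
        (settingOfRecord₁₃ F N θ p).lf (settingOfRecord₁₃ F N θ p).βc 0) ∧
      (slotsTOfRecord F N θ.ν θ.τ9 (EOfRecord₁₃ F N θ) (wOfRecord₉ F N θ.toStage9Params) θ.ppSel p
          (gOfRecord₁₃ F N θ p) 1 s = 0 ∨
        ∀ᵐ V1 ∂fieldMeasure (F.P p.K) 1 (SU N),
          slotsTOfRecord F N θ.ν θ.τ9 (EOfRecord₁₃ F N θ) (wOfRecord₉ F N θ.toStage9Params) θ.ppSel p
              (gOfRecord₁₃ F N θ p) 1 s V1 =
            sect2Slot F N (FluctV N) p.K (settingOfRecord₁₃ F N θ p) (θ.Rz p.K) (WtOfRecord₁₃ F N θ p) s (t s) (Ek s)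
              (UbgOfRecord₁₃ F N θ p 1 s) V1) := by
  obtain ⟨t, Ek, hu, hs⟩ := (tLaw₁₃_iff F N θ p 0).mp hT
  refine ⟨t, Ek, hu, fun s' => (hs s').1, ?_⟩
  rcases (hs s).2 with h0 | hid
  · exact Or.inl h0
  · refine Or.inr ?_
    filter_upwards [hid] with V1 hV1
    exact hV1 (by rw [chiSeqOfRecord_eq_one_of_Omega_empty F N θ.ν θ.τ9.M _ p.K 1 s hΩ V1]; exact one_ne_zero)

/-- **THE LEVEL-1 NO-EXPANSION COHERENCE EQUATION AT THE STAGE-13 RECORD, IN KERNEL**: at `s′` with `Ω₁(s′) = ∅`, for a witness pair `(t, E_1)` of the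
(S1ᵀ)₁₃,₀ dichotomy there and under the displayed measurability∕boundedness of the no-expansion integrand (`0 < K`), EITHER the pre-𝐑 slot `slotT_1(s′)` is the
zero function OR the two ONE-STEP TRANSPORTS OF RECORD agree `dV₁`-a.e.:
`∫dU δ(ŪV₁⁻¹) w(s′)(U,V₁)·ρ₀(U) = ∫dU δ(ŪV₁⁻¹) ζ0_0(T)·χreg_0(T)·e^{−½quad_0(∅)}·exp A_1(s′)(U_1) (U, V₁)` — def-T's step weights of record against 12a's
𝐓-weights of record and the §2 operand along `gOfRecord₁₃`, ZERO new terms. [cite: Balaban1988Convergent, Theorem p.245, (3.1) p.264, (3.25) p.270, (2.21)–(2.23) p.258] -/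
theorem tLaw₁₃_zero_coherence_of_Omega_empty (hK : 0 < p.K)
    (s : SeqOfRecord F θ.ν θ.τ9.M (gOfRecord₁₃ F N θ p) p.K 1) (hΩ : s.Ω 1 = ∅)
    (t : Sect2.TermValues (F.P p.K) (MatA N) (FluctV N) θ.τ9.M) (Ek : ℝ)
    (hcl : slotsTOfRecord F N θ.ν θ.τ9 (EOfRecord₁₃ F N θ) (wOfRecord₉ F N θ.toStage9Params) θ.ppSel p
          (gOfRecord₁₃ F N θ p) 1 s = 0 ∨
        ∀ᵐ V1 ∂fieldMeasure (F.P p.K) 1 (SU N),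
          slotsTOfRecord F N θ.ν θ.τ9 (EOfRecord₁₃ F N θ) (wOfRecord₉ F N θ.toStage9Params) θ.ppSel p
              (gOfRecord₁₃ F N θ p) 1 s V1 =
            sect2Slot F N (FluctV N) p.K (settingOfRecord₁₃ F N θ p) (θ.Rz p.K) (WtOfRecord₁₃ F N θ p) s t Ek
              (UbgOfRecord₁₃ F N θ p 1 s) V1)
    {C : ℝ}
    (hm : Measurable (Function.uncurry (noExpIntegrand F N (FluctV N) p.K (WtOfRecord₁₃ F N θ p)
      (sect2Operand F N (FluctV N) p.K (settingOfRecord₁₃ F N θ p) (θ.Rz p.K) s t Ek (UbgOfRecord₁₃ F N θ p 1 s)))))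
    (hC : ∀ V1 Uf, |noExpIntegrand F N (FluctV N) p.K (WtOfRecord₁₃ F N θ p)
      (sect2Operand F N (FluctV N) p.K (settingOfRecord₁₃ F N θ p) (θ.Rz p.K) s t Ek (UbgOfRecord₁₃ F N θ p 1 s)) V1 Uf| ≤ C) :
    slotsTOfRecord F N θ.ν θ.τ9 (EOfRecord₁₃ F N θ) (wOfRecord₉ F N θ.toStage9Params) θ.ppSel p
        (gOfRecord₁₃ F N θ p) 1 s = 0 ∨
      (fun V1 => transportOfRecord F N p.K 0 (fun U => wOfRecord₉ F N θ.toStage9Params p (gOfRecord₁₃ F N θ p) 0 s U V1 *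
          rhoZeroOfRecord F N p.K (gOfRecord₁₃ F N θ p 0) (EOfRecord₁₃ F N θ p) U) V1)
        =ᵐ[fieldMeasure (F.P p.K) 1 (SU N)]
      fun V1 => transportOfRecord F N p.K 0 (noExpIntegrand F N (FluctV N) p.K (WtOfRecord₁₃ F N θ p)
        (sect2Operand F N (FluctV N) p.K (settingOfRecord₁₃ F N θ p) (θ.Rz p.K) s t Ek (UbgOfRecord₁₃ F N θ p 1 s)) V1) V1 := by
  rcases hcl with h0 | hid
  · exact Or.inl h0
  · refine Or.inr ?_
    filter_upwards [hid, sect2Slot_one_ae_eq_transport_of_Omega_empty₁₃ θ p hK s hΩ t Ek (UbgOfRecord₁₃ F N θ p 1 s) hm hC] with V1 h1 h2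
    rw [← slotsTOfRecord_one_apply, h1, h2]

/-- **SUFFICIENCY: A FIBRE IDENTITY OF INTEGRANDS DISCHARGES THE IDENTITY BRANCH AT `s′`, Stage 13** (what a K1‴ witness's `Zt` must meet at its first
no-expansion step): if for EVERY fine field `U` the step-weighted Wilson start `w(s′)(U, Ū)·ρ₀(U)` EQUALS the no-expansion integrand
`ζ0_0(T)·χreg_0(T)·e^{−½quad_0(∅)}·exp A_1(s′)(U_1) (U, Ū)` ON THE GRAPH `V₁ = Ū`, then (under the displayed measurability∕boundedness, `0 < K`) the
(3.25) identity `slotT_1(s′)(V₁) = 𝐓_1(s′) exp A_1(s′)(V₁)` holds for `dV₁`-a.e. `V₁` — for this term-value witness, constant and background map.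
[cite: Balaban1988Convergent, (3.25) p.270, Theorem p.245, (3.1) p.264, (2.18) p.257] -/
theorem slotsT_one_ae_eq_sect2Slot_of_fibre_identity₁₃ (hK : 0 < p.K)
    (s : SeqOfRecord F θ.ν θ.τ9.M (gOfRecord₁₃ F N θ p) p.K 1) (hΩ : s.Ω 1 = ∅)
    (t : Sect2.TermValues (F.P p.K) (MatA N) (FluctV N) θ.τ9.M) (Ek : ℝ) (U : BgMap F N p.K) {C : ℝ}
    (hm : Measurable (Function.uncurry (noExpIntegrand F N (FluctV N) p.K (WtOfRecord₁₃ F N θ p)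
      (sect2Operand F N (FluctV N) p.K (settingOfRecord₁₃ F N θ p) (θ.Rz p.K) s t Ek U))))
    (hC : ∀ V1 Uf, |noExpIntegrand F N (FluctV N) p.K (WtOfRecord₁₃ F N θ p)
      (sect2Operand F N (FluctV N) p.K (settingOfRecord₁₃ F N θ p) (θ.Rz p.K) s t Ek U) V1 Uf| ≤ C)
    (hfib : ∀ Uf : GaugeField (F.P p.K) 0 (SU N),
      wOfRecord₉ F N θ.toStage9Params p (gOfRecord₁₃ F N θ p) 0 s Uf ((avOfRecord F N p.K 0).avg Uf) *
          rhoZeroOfRecord F N p.K (gOfRecord₁₃ F N θ p 0) (EOfRecord₁₃ F N θ p) Uf =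
        noExpIntegrand F N (FluctV N) p.K (WtOfRecord₁₃ F N θ p)
          (sect2Operand F N (FluctV N) p.K (settingOfRecord₁₃ F N θ p) (θ.Rz p.K) s t Ek U) ((avOfRecord F N p.K 0).avg Uf) Uf) :
    ∀ᵐ V1 ∂fieldMeasure (F.P p.K) 1 (SU N),
      chiSeqOfRecord F N θ.ν θ.τ9.M (gOfRecord₁₃ F N θ p) p.K 1 s V1 ≠ 0 →
        slotsTOfRecord F N θ.ν θ.τ9 (EOfRecord₁₃ F N θ) (wOfRecord₉ F N θ.toStage9Params) θ.ppSel p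
            (gOfRecord₁₃ F N θ p) 1 s V1 =
          sect2Slot F N (FluctV N) p.K (settingOfRecord₁₃ F N θ p) (θ.Rz p.K) (WtOfRecord₁₃ F N θ p) s t Ek U V1 := by
  have h1 := transportK_congr_ae_of_fibre (avOfRecord_measurable F N p.K 0) (avOfRecord_haarAC F N p.K 0 hK)
    (f := fun V1 Uf => wOfRecord₉ F N θ.toStage9Params p (gOfRecord₁₃ F N θ p) 0 s Uf V1 *
      rhoZeroOfRecord F N p.K (gOfRecord₁₃ F N θ p 0) (EOfRecord₁₃ F N θ p) Uf)
    (g := noExpIntegrand F N (FluctV N) p.K (WtOfRecord₁₃ F N θ p)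
      (sect2Operand F N (FluctV N) p.K (settingOfRecord₁₃ F N θ p) (θ.Rz p.K) s t Ek U)) hfib
  have h2 := sect2Slot_one_ae_eq_transport_of_Omega_empty₁₃ θ p hK s hΩ t Ek U hm hC
  filter_upwards [h1, h2] with V1 e1 e2 _
  rw [slotsTOfRecord_one_apply, e2]
  exact e1

/-- **… HENCE THE WHOLE (S1ᵀ)₁₃,₀ DICHOTOMY CLAUSE AT `s′`** (`HasSect2FormAtZ`'s third conjunct, identity branch), from the fibre identity.
[cite: Balaban1988Convergent, (3.25) p.270, (2.17)–(2.18) p.257] -/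
theorem hasSect2FormAtZ_clause_one_of_fibre_identity₁₃ (hK : 0 < p.K)
    (s : SeqOfRecord F θ.ν θ.τ9.M (gOfRecord₁₃ F N θ p) p.K 1) (hΩ : s.Ω 1 = ∅)
    (t : Sect2.TermValues (F.P p.K) (MatA N) (FluctV N) θ.τ9.M) (Ek : ℝ) (U : BgMap F N p.K) {C : ℝ}
    (hm : Measurable (Function.uncurry (noExpIntegrand F N (FluctV N) p.K (WtOfRecord₁₃ F N θ p)
      (sect2Operand F N (FluctV N) p.K (settingOfRecord₁₃ F N θ p) (θ.Rz p.K) s t Ek U))))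
    (hC : ∀ V1 Uf, |noExpIntegrand F N (FluctV N) p.K (WtOfRecord₁₃ F N θ p)
      (sect2Operand F N (FluctV N) p.K (settingOfRecord₁₃ F N θ p) (θ.Rz p.K) s t Ek U) V1 Uf| ≤ C)
    (hfib : ∀ Uf : GaugeField (F.P p.K) 0 (SU N),
      wOfRecord₉ F N θ.toStage9Params p (gOfRecord₁₃ F N θ p) 0 s Uf ((avOfRecord F N p.K 0).avg Uf) *
          rhoZeroOfRecord F N p.K (gOfRecord₁₃ F N θ p 0) (EOfRecord₁₃ F N θ p) Uf =
        noExpIntegrand F N (FluctV N) p.K (WtOfRecord₁₃ F N θ p)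
          (sect2Operand F N (FluctV N) p.K (settingOfRecord₁₃ F N θ p) (θ.Rz p.K) s t Ek U) ((avOfRecord F N p.K 0).avg Uf) Uf) :
    slotsTOfRecord F N θ.ν θ.τ9 (EOfRecord₁₃ F N θ) (wOfRecord₉ F N θ.toStage9Params) θ.ppSel p
          (gOfRecord₁₃ F N θ p) 1 s = 0 ∨
      ∀ᵐ V1 ∂fieldMeasure (F.P p.K) 1 (SU N),
        chiSeqOfRecord F N θ.ν θ.τ9.M (gOfRecord₁₃ F N θ p) p.K 1 s V1 ≠ 0 →
          slotsTOfRecord F N θ.ν θ.τ9 (EOfRecord₁₃ F N θ) (wOfRecord₉ F N θ.toStage9Params) θ.ppSel p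
              (gOfRecord₁₃ F N θ p) 1 s V1 =
            sect2Slot F N (FluctV N) p.K (settingOfRecord₁₃ F N θ p) (θ.Rz p.K) (WtOfRecord₁₃ F N θ p) s t Ek U V1 :=
  Or.inr (slotsT_one_ae_eq_sect2Slot_of_fibre_identity₁₃ θ p hK s hΩ t Ek U hm hC hfib)

end LevelOne

/-! ## §2  The background of record at the all-large-field sequence IS the fine field (on print's class), Stage 13; unchanged along a no-expansion step -/

section Background

variable (θ : Stage13Params F N) (p : B12.RunParams)

/-- **THE STAGE-13 BACKGROUND MAP OF RECORD AT LEVEL 1, ALL-LARGE-FIELD SEQUENCE**: `U_1(s′)(𝐖) = 𝐖 0` for `ε₀`-regular `𝐖 0` (def-R's `UbgMSOfRecord` along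
`gOfRecord₁₃`: the minimiser is forced by the constraint). [cite: Balaban1988Convergent, (2.12) p.256, Thm 1 p.262; Balaban1985Variational, Thm 1 (8) p.279] -/
theorem UbgOfRecord₁₃_one_of_Omega_empty (s : SeqOfRecord F θ.ν θ.τ9.M (gOfRecord₁₃ F N θ p) p.K 1) (hΩ : s.Ω 1 = ∅)
    (W : MSField (F.P p.K) (SU N)) (hW : PlaqSmall (θ.ν.εreg * (F.P p.K).eta 0 ^ 2) (W 0)) : UbgOfRecord₁₃ F N θ p 1 s W = W 0 :=
  UbgMSOfRecord_one_of_Omega_empty θ.ν θ.τ9.M _ p.K s hΩ W hW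

/-- … and `= 1` (junk) for an irregular `𝐖 0`. [cite: Balaban1988Convergent, (2.12) p.256 (typing convention)] -/
theorem UbgOfRecord₁₃_one_of_Omega_empty_of_not (s : SeqOfRecord F θ.ν θ.τ9.M (gOfRecord₁₃ F N θ p) p.K 1) (hΩ : s.Ω 1 = ∅)
    (W : MSField (F.P p.K) (SU N)) (hW : ¬ PlaqSmall (θ.ν.εreg * (F.P p.K).eta 0 ^ 2) (W 0)) : UbgOfRecord₁₃ F N θ p 1 s W = fun _ => 1 :=
  UbgMSOfRecord_one_of_Omega_empty_of_not θ.ν θ.τ9.M _ p.K s hΩ W hW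

/-- At the two-scale configuration `(U, V₁)` the Stage-13 background of record at level 1 is the integrated fine field `U` itself (for `ε₀`-regular `U`).
[cite: Balaban1988Convergent, (2.12) p.256, Thm 1 p.262] -/
theorem UbgOfRecord₁₃_one_pairCfg_of_Omega_empty (s : SeqOfRecord F θ.ν θ.τ9.M (gOfRecord₁₃ F N θ p) p.K 1) (hΩ : s.Ω 1 = ∅)
    (V1 : GaugeField (F.P p.K) 1 (SU N)) (Uf : GaugeField (F.P p.K) 0 (SU N)) (hU : PlaqSmall (θ.ν.εreg * (F.P p.K).eta 0 ^ 2) Uf) :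
    UbgOfRecord₁₃ F N θ p 1 s (fun j => (pairCfg (V := FluctV N) V1 Uf j).1) = Uf :=
  UbgOfRecord₁₃_one_of_Omega_empty θ p s hΩ _ (by rw [pairCfg_zero]; exact hU)

/-- **THE NO-EXPANSION INTEGRAND AT THE STAGE-13 RECORD WITH THE BACKGROUND RESOLVED**: for an `ε₀`-regular fine field `U` the §2 operand at the background of
record reads `exp A_1(s′)(U)` — the action at the integrated field itself, as print's `U₁ = V₀`. [cite: Balaban1988Convergent, (2.18) p.257, (2.23) p.258, (2.12) p.256, Thm 1 p.262] -/
theorem noExpIntegrand_WtOfRecord₁₃_sect2Operand_of_regular (s : SeqOfRecord F θ.ν θ.τ9.M (gOfRecord₁₃ F N θ p) p.K 1)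
    (hΩ : s.Ω 1 = ∅) (t : Sect2.TermValues (F.P p.K) (MatA N) (FluctV N) θ.τ9.M) (Ek : ℝ) (V1 : GaugeField (F.P p.K) 1 (SU N))
    (Uf : GaugeField (F.P p.K) 0 (SU N)) (hU : PlaqSmall (θ.ν.εreg * (F.P p.K).eta 0 ^ 2) Uf) :
    noExpIntegrand F N (FluctV N) p.K (WtOfRecord₁₃ F N θ p)
        (sect2Operand F N (FluctV N) p.K (settingOfRecord₁₃ F N θ p) (θ.Rz p.K) s t Ek (UbgOfRecord₁₃ F N θ p 1 s)) V1 Uf =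
      (θ.Zt p.K).ζ0 0 Set.univ (pairCfg V1 Uf) *
          chiRegW F N (FluctV N) θ.ν θ.s2.cR p (gOfRecord₁₃ F N θ p) 0 Set.univ (pairCfg V1 Uf) *
        (Real.exp (-(1 / 2 : ℝ) * (θ.Zt p.K).quad 0 ∅ (pairCfg V1 Uf)) *
          Real.exp ((sect2ActionDataOfRecord F N (FluctV N) p.K (settingOfRecord₁₃ F N θ p) (θ.Rz p.K) s t
            (fun _ => ∅, fun j => (pairCfg (V := FluctV N) V1 Uf j).2) Ek).action23 1 Uf)) := by
  rw [noExpIntegrand_WtOfRecord₁₃_sect2Operand, UbgOfRecord₁₃_one_pairCfg_of_Omega_empty θ p s hΩ V1 Uf hU]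

/-- **… AND IT VANISHES OFF THE p. 256 REGULAR SET** (the factor `χreg_0(T)(U) = 0`): the no-expansion integrand at the Stage-13 record is supported on the
`cR·ε₀`-regular fine fields, for every operand. [cite: Balaban1988Convergent, (2.10) p.256, (2.21) p.258] -/
theorem noExpIntegrand_WtOfRecord₁₃_eq_zero_of_chiRegW_eq_zero (Φ : SFluct (F.P p.K) (FluctV N) → MSField (F.P p.K) (SU N) → ℝ)
    (V1 : GaugeField (F.P p.K) 1 (SU N)) (Uf : GaugeField (F.P p.K) 0 (SU N))
    (h : chiRegW F N (FluctV N) θ.ν θ.s2.cR p (gOfRecord₁₃ F N θ p) 0 Set.univ (pairCfg (V := FluctV N) V1 Uf) = 0) :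
    noExpIntegrand F N (FluctV N) p.K (WtOfRecord₁₃ F N θ p) Φ V1 Uf = 0 := by
  rw [WtOfRecord₁₃_eq, noExpIntegrand_tkWeightsOfRecord, h, mul_zero, zero_mul]

/-- **THE COHERENCE EQUATION'S RIGHT-HAND INTEGRAND ON THE REGULAR SET, WITH THE LETTERS' JUNCTION `cR·ε₀ ≤ ε₀^{reg}·η₀²` ALONG `gOfRecord₁₃`**: wherever the
regularity factor does not vanish, the background of record is the fine field and the integrand is `ζ0_0(T)·χreg_0(T)·e^{−½quad_0(∅)}·exp A_1(s′)(U)` at `(U, V₁)`.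
[cite: Balaban1988Convergent, (2.10) p.256, (2.12) p.256, (2.18) p.257, (2.21)–(2.23) p.258] -/
theorem noExpIntegrand_WtOfRecord₁₃_sect2Operand_of_chiRegW_ne_zero (hc : θ.s2.cR * epsOfRecord θ.ν (gOfRecord₁₃ F N θ p) 0 ≤
      θ.ν.εreg * (F.P p.K).eta 0 ^ 2)
    (s : SeqOfRecord F θ.ν θ.τ9.M (gOfRecord₁₃ F N θ p) p.K 1) (hΩ : s.Ω 1 = ∅)
    (t : Sect2.TermValues (F.P p.K) (MatA N) (FluctV N) θ.τ9.M) (Ek : ℝ) (V1 : GaugeField (F.P p.K) 1 (SU N)) (Uf : GaugeField (F.P p.K) 0 (SU N))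
    (h : chiRegW F N (FluctV N) θ.ν θ.s2.cR p (gOfRecord₁₃ F N θ p) 0 Set.univ (pairCfg (V := FluctV N) V1 Uf) ≠ 0) :
    noExpIntegrand F N (FluctV N) p.K (WtOfRecord₁₃ F N θ p)
        (sect2Operand F N (FluctV N) p.K (settingOfRecord₁₃ F N θ p) (θ.Rz p.K) s t Ek (UbgOfRecord₁₃ F N θ p 1 s)) V1 Uf =
      (θ.Zt p.K).ζ0 0 Set.univ (pairCfg V1 Uf) *
          chiRegW F N (FluctV N) θ.ν θ.s2.cR p (gOfRecord₁₃ F N θ p) 0 Set.univ (pairCfg V1 Uf) *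
        (Real.exp (-(1 / 2 : ℝ) * (θ.Zt p.K).quad 0 ∅ (pairCfg V1 Uf)) *
          Real.exp ((sect2ActionDataOfRecord F N (FluctV N) p.K (settingOfRecord₁₃ F N θ p) (θ.Rz p.K) s t
            (fun _ => ∅, fun j => (pairCfg (V := FluctV N) V1 Uf j).2) Ek).action23 1 Uf)) :=
  noExpIntegrand_WtOfRecord₁₃_sect2Operand_of_regular θ p s hΩ t Ek V1 Uf (plaqSmall_of_chiRegW_zero_univ_ne_zero hc h)

/-- **THE STAGE-13 BACKGROUND MAP OF RECORD IS UNCHANGED ALONG A NO-EXPANSION STEP, `k ≥ 1`**: `UbgOfRecord₁₃ θ p (k+1) s′ = UbgOfRecord₁₃ θ p k (init s′)`.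
[cite: Balaban1988Convergent, (2.12)–(2.13) pp.256–257] -/
theorem UbgOfRecord₁₃_succ_eq_init_of_Omega_empty {k : ℕ} (hk : 1 ≤ k)
    (s : SeqOfRecord F θ.ν θ.τ9.M (gOfRecord₁₃ F N θ p) p.K (k + 1)) (hΩ : s.Ω (k + 1) = ∅) :
    UbgOfRecord₁₃ F N θ p (k + 1) s = UbgOfRecord₁₃ F N θ p k s.init := by
  obtain ⟨k', rfl⟩ : ∃ k', k = k' + 1 := ⟨k - 1, by omega⟩
  rw [UbgOfRecord₁₃_succ, UbgOfRecord₁₃_succ]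
  exact UbgMSOfRecord_succ_eq_init_of_Omega_empty N hk s hΩ

/-- **… AND AT `k = 0` ON PRINT'S CLASS** (the level-`0` pin `𝐖 ↦ 𝐖 0` of Record13 against the level-`1` minimiser): `U_1(s′)(𝐖) = U_0(init s′)(𝐖) = 𝐖 0` for
`ε₀`-regular `𝐖 0`. [cite: Balaban1988Convergent, Thm 1 p.262, (2.12) p.256] -/
theorem UbgOfRecord₁₃_one_eq_init_of_Omega_empty (s : SeqOfRecord F θ.ν θ.τ9.M (gOfRecord₁₃ F N θ p) p.K 1) (hΩ : s.Ω 1 = ∅)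
    (W : MSField (F.P p.K) (SU N)) (hW : PlaqSmall (θ.ν.εreg * (F.P p.K).eta 0 ^ 2) (W 0)) :
    UbgOfRecord₁₃ F N θ p 1 s W = UbgOfRecord₁₃ F N θ p 0 s.init W := by
  rw [UbgOfRecord₁₃_one_of_Omega_empty θ p s hΩ W hW]
  rfl

end Background

/-! ## §3  LEVEL k+1 at the Stage-13 record: the pre-𝐑 slot under `SLaw₁₃ θ p k`, the §2-form slot at a no-expansion `s′`, (S1ᵀ)₁₃,ₖ there as a transport equation -/

section LevelSucc

variable (θ : Stage13Params F N) (p : B12.RunParams)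

/-- **UNDER `SLaw₁₃ θ p k` THE PRE-𝐑 SLOT AT LEVEL k+1 IS THE TRANSPORT OF `w(s′)·χ_k·𝐓_k(init s′)e^{A_k(init s′)}`** (or the zero function): the §2 dichotomy at
`init s′` along `gOfRecord₁₃` — slot absent (then `slotT_{k+1}(s′) ≡ 0` POINTWISE), or the (2.18) identity a.e. on the `χ_k`-support (then the integrand families agree
for `dU`-a.e. `U` at every `V′`, and the transport respects that: `transportK_congr_ae_family`, `k < K`).
[cite: Balaban1988Convergent, (2.18) p.257, Thm 1 p.262, (3.1) p.264, (3.25) p.270] -/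
theorem slotsTOfRecord_succ_of_sLaw₁₃ {k : ℕ} (hk : k < p.K) (hS : SLaw₁₃ F N θ p k)
    (s : SeqOfRecord F θ.ν θ.τ9.M (gOfRecord₁₃ F N θ p) p.K (k + 1)) :
    ∃ (t : SeqOfRecord F θ.ν θ.τ9.M (gOfRecord₁₃ F N θ p) p.K k → Sect2.TermValues (F.P p.K) (MatA N) (FluctV N) θ.τ9.M)
      (Ek : SeqOfRecord F θ.ν θ.τ9.M (gOfRecord₁₃ F N θ p) p.K k → ℝ),
      Sect2.UniversalE t ∧
      (∀ s₀, Sect2.LawsRT (sect2TowerOfRecord F N (FluctV N) p.K (settingOfRecord₁₃ F N θ p) (θ.Rz p.K) s₀ (t s₀)) (settingOfRecord₁₃ F N θ p).lf k) ∧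
      (slotsTOfRecord F N θ.ν θ.τ9 (EOfRecord₁₃ F N θ) (wOfRecord₉ F N θ.toStage9Params) θ.ppSel p
          (gOfRecord₁₃ F N θ p) (k + 1) s = 0 ∨
        slotsTOfRecord F N θ.ν θ.τ9 (EOfRecord₁₃ F N θ) (wOfRecord₉ F N θ.toStage9Params) θ.ppSel p
            (gOfRecord₁₃ F N θ p) (k + 1) s =ᵐ[fieldMeasure (F.P p.K) (k + 1) (SU N)]
          fun V' => transportOfRecord F N p.K k (fun U =>
            wOfRecord₉ F N θ.toStage9Params p (gOfRecord₁₃ F N θ p) k s U V' *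
              (chiSeqOfRecord F N θ.ν θ.τ9.M (gOfRecord₁₃ F N θ p) p.K k s.init U *
                sect2Slot F N (FluctV N) p.K (settingOfRecord₁₃ F N θ p) (θ.Rz p.K) (WtOfRecord₁₃ F N θ p) s.init (t s.init) (Ek s.init)
                  (UbgOfRecord₁₃ F N θ p k s.init) U)) V') := by
  obtain ⟨t, Ek, hu, hs⟩ := (sLaw₁₃_iff F N θ p k).mp hS
  refine ⟨t, Ek, hu, fun s₀ => (hs s₀).1, ?_⟩
  rcases (hs s.init).2 with h0 | hid
  · refine Or.inl ?_
    funext V'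
    rw [slotsTOfRecord_succ_apply, h0]
    show transportOfRecord F N p.K k (fun U => _ * (_ * (0 : ℝ))) V' = 0
    simp only [mul_zero]
    show kernelTransport _ _ _ (fun _ => (0 : ℝ)) V' = 0
    simp only [kernelTransport, integral_zero, mul_zero]
  · refine Or.inr ?_
    have h := transportK_congr_ae_family (avOfRecord_measurable F N p.K k) (avOfRecord_haarAC F N p.K k hk)
      (f := fun V' U => wOfRecord₉ F N θ.toStage9Params p (gOfRecord₁₃ F N θ p) k s U V' *
        (chiSeqOfRecord F N θ.ν θ.τ9.M (gOfRecord₁₃ F N θ p) p.K k s.init U *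
          slotsOfRecord F N θ.ν θ.τ9 (EOfRecord₁₃ F N θ) (wOfRecord₉ F N θ.toStage9Params) θ.ppSel p
            (gOfRecord₁₃ F N θ p) k s.init U))
      (g := fun V' U => wOfRecord₉ F N θ.toStage9Params p (gOfRecord₁₃ F N θ p) k s U V' *
        (chiSeqOfRecord F N θ.ν θ.τ9.M (gOfRecord₁₃ F N θ p) p.K k s.init U *
          sect2Slot F N (FluctV N) p.K (settingOfRecord₁₃ F N θ p) (θ.Rz p.K) (WtOfRecord₁₃ F N θ p) s.init (t s.init) (Ek s.init)
            (UbgOfRecord₁₃ F N θ p k s.init) U))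
      (hid.mono fun U hU V' => by
        by_cases hχ : chiSeqOfRecord F N θ.ν θ.τ9.M (gOfRecord₁₃ F N θ p) p.K k s.init U = 0
        · simp only [hχ, zero_mul, mul_zero]
        · rw [hU hχ])
    filter_upwards [h] with V' hV'
    rw [slotsTOfRecord_succ_apply]
    exact hV'

/-- **THE §2-FORM SLOT `𝐓_{k+1}(s′) exp A_{k+1}(s′)` OF RECORD (Stage 13) AT A NO-EXPANSION `s′`, UNFOLDED POINTWISE**: the sum over the old index of restricted
kernel transports on the full bond sets of the no-expansion integrands of the old branches of the §2 operand. [cite: Balaban1988Convergent, (2.18) p.257, (2.21)–(2.23) p.258, (3.24) p.270] -/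
theorem sect2Slot_succ_eq_sum_kernelRT_of_Omega_empty₁₃ {k : ℕ}
    (s : SeqOfRecord F θ.ν θ.τ9.M (gOfRecord₁₃ F N θ p) p.K (k + 1)) (hΩ : s.Ω (k + 1) = ∅)
    (t : Sect2.TermValues (F.P p.K) (MatA N) (FluctV N) θ.τ9.M) (Ek : ℝ) (U : BgMap F N p.K) (V' : GaugeField (F.P p.K) (k + 1) (SU N))
    {hdec : DecidableEq (PBond (F.P p.K) k)} :
    sect2Slot F N (FluctV N) p.K (settingOfRecord₁₃ F N θ p) (θ.Rz p.K) (WtOfRecord₁₃ F N θ p) s t Ek U V' =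
      ∑ S ∈ admSOfRecord F θ.ν θ.τ9.M (gOfRecord₁₃ F N θ p) p.K k s.init,
        kernelRTOfRecord F N p.K k (genDataOfRecord F N (FluctV N) θ.ν θ.τ9.M _ p.K (WtOfRecord₁₃ F N θ p) s (fun _ => ∅) k).sV
          (genDataOfRecord F N (FluctV N) θ.ν θ.τ9.M _ p.K (WtOfRecord₁₃ F N θ p) s (fun _ => ∅) k).sV'
          (fun y => noExpIntegrandAt F N (FluctV N) p.K k (WtOfRecord₁₃ F N θ p)
            (tkBranchOfRecord F N (FluctV N) θ.ν θ.τ9.M _ p.K (WtOfRecord₁₃ F N θ p) s.init S k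
              (fun ω => sect2Operand F N (FluctV N) p.K (settingOfRecord₁₃ F N θ p) (θ.Rz p.K) s t Ek U (S, fun j => (ω j).2) (fun j => (ω j).1)))
            V' (Function.updateFinset (fun _ => 1) (genDataOfRecord F N (FluctV N) θ.ν θ.τ9.M _ p.K (WtOfRecord₁₃ F N θ p) s (fun _ => ∅) k).sV y))
          (fun b => V' b) :=
  TkOfRecord_succ_eq_sum_kernelRT_of_Omega_empty θ.ν θ.τ9.M _ p.K (WtOfRecord₁₃ F N θ p) s hΩ _ V'

/-- **… AND ALMOST EVERYWHERE AS A SUM OF def-T's TRANSPORTS OF RECORD** (`k < K`; displayed joint measurability + bound per old branch).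
[cite: Balaban1988Convergent, (2.18) p.257, (3.1) p.264, (3.25) p.270] -/
theorem sect2Slot_succ_ae_eq_sum_transport_of_Omega_empty₁₃ {k : ℕ} (hk : k < p.K)
    (s : SeqOfRecord F θ.ν θ.τ9.M (gOfRecord₁₃ F N θ p) p.K (k + 1)) (hΩ : s.Ω (k + 1) = ∅)
    (t : Sect2.TermValues (F.P p.K) (MatA N) (FluctV N) θ.τ9.M) (Ek : ℝ) (U : BgMap F N p.K) {C : ℝ}
    (hm : ∀ S ∈ admSOfRecord F θ.ν θ.τ9.M (gOfRecord₁₃ F N θ p) p.K k s.init,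
      Measurable (Function.uncurry (noExpIntegrandAt F N (FluctV N) p.K k (WtOfRecord₁₃ F N θ p)
        (tkBranchOfRecord F N (FluctV N) θ.ν θ.τ9.M _ p.K (WtOfRecord₁₃ F N θ p) s.init S k
          (fun ω => sect2Operand F N (FluctV N) p.K (settingOfRecord₁₃ F N θ p) (θ.Rz p.K) s t Ek U (S, fun j => (ω j).2) (fun j => (ω j).1))))))
    (hC : ∀ S ∈ admSOfRecord F θ.ν θ.τ9.M (gOfRecord₁₃ F N θ p) p.K k s.init, ∀ V' U₀,
      |noExpIntegrandAt F N (FluctV N) p.K k (WtOfRecord₁₃ F N θ p)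
        (tkBranchOfRecord F N (FluctV N) θ.ν θ.τ9.M _ p.K (WtOfRecord₁₃ F N θ p) s.init S k
          (fun ω => sect2Operand F N (FluctV N) p.K (settingOfRecord₁₃ F N θ p) (θ.Rz p.K) s t Ek U (S, fun j => (ω j).2) (fun j => (ω j).1)))
        V' U₀| ≤ C) :
    sect2Slot F N (FluctV N) p.K (settingOfRecord₁₃ F N θ p) (θ.Rz p.K) (WtOfRecord₁₃ F N θ p) s t Ek U =ᵐ[fieldMeasure (F.P p.K) (k + 1) (SU N)]
      fun V' => ∑ S ∈ admSOfRecord F θ.ν θ.τ9.M (gOfRecord₁₃ F N θ p) p.K k s.init,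
        transportOfRecord F N p.K k (noExpIntegrandAt F N (FluctV N) p.K k (WtOfRecord₁₃ F N θ p)
          (tkBranchOfRecord F N (FluctV N) θ.ν θ.τ9.M _ p.K (WtOfRecord₁₃ F N θ p) s.init S k
            (fun ω => sect2Operand F N (FluctV N) p.K (settingOfRecord₁₃ F N θ p) (θ.Rz p.K) s t Ek U (S, fun j => (ω j).2) (fun j => (ω j).1)))
          V') V' :=
  TkOfRecord_succ_ae_eq_sum_transportOfRecord_of_Omega_empty θ.ν θ.τ9.M _ p.K (WtOfRecord₁₃ F N θ p) hk s hΩ _ hm hC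

/-- **THE (S1ᵀ)₁₃,ₖ CLAUSE AT A NO-EXPANSION `s′`, GUARD-FREE**: if `TLaw₁₃ θ p k` holds, its witness satisfies at `s′` with `Ω_{k+1}(s′) = ∅` «`slotT_{k+1}(s′) = 0`
or `slotT_{k+1}(s′)(V′) = 𝐓_{k+1}(s′) exp A_{k+1}(s′)(V′)` `dV′`-a.e.» — `χ_{k+1}(s′) ≡ 1` there. [cite: Balaban1988Convergent, (3.25) p.270, remark p.262, Theorem p.245] -/
theorem tLaw₁₃_clause_of_Omega_empty {k : ℕ} (hT : TLaw₁₃ F N θ p k)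
    (s : SeqOfRecord F θ.ν θ.τ9.M (gOfRecord₁₃ F N θ p) p.K (k + 1)) (hΩ : s.Ω (k + 1) = ∅) :
    ∃ (t : SeqOfRecord F θ.ν θ.τ9.M (gOfRecord₁₃ F N θ p) p.K (k + 1) → Sect2.TermValues (F.P p.K) (MatA N) (FluctV N) θ.τ9.M)
      (Ek : SeqOfRecord F θ.ν θ.τ9.M (gOfRecord₁₃ F N θ p) p.K (k + 1) → ℝ),
      Sect2.UniversalE t ∧
      (∀ s', Sect2.LawsT (sect2TowerOfRecord F N (FluctV N) p.K (settingOfRecord₁₃ F N θ p) (θ.Rz p.K) s' (t s'))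
        (settingOfRecord₁₃ F N θ p).lf (settingOfRecord₁₃ F N θ p).βc k) ∧
      (slotsTOfRecord F N θ.ν θ.τ9 (EOfRecord₁₃ F N θ) (wOfRecord₉ F N θ.toStage9Params) θ.ppSel p
          (gOfRecord₁₃ F N θ p) (k + 1) s = 0 ∨
        ∀ᵐ V' ∂fieldMeasure (F.P p.K) (k + 1) (SU N),
          slotsTOfRecord F N θ.ν θ.τ9 (EOfRecord₁₃ F N θ) (wOfRecord₉ F N θ.toStage9Params) θ.ppSel p
              (gOfRecord₁₃ F N θ p) (k + 1) s V' =
            sect2Slot F N (FluctV N) p.K (settingOfRecord₁₃ F N θ p) (θ.Rz p.K) (WtOfRecord₁₃ F N θ p) s (t s) (Ek s)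
              (UbgOfRecord₁₃ F N θ p (k + 1) s) V') := by
  obtain ⟨t, Ek, hu, hs⟩ := (tLaw₁₃_iff F N θ p k).mp hT
  refine ⟨t, Ek, hu, fun s' => (hs s').1, ?_⟩
  rcases (hs s).2 with h0 | hid
  · exact Or.inl h0
  · refine Or.inr ?_
    filter_upwards [hid] with V' hV'
    exact hV' (by rw [chiSeqOfRecord_eq_one_of_Omega_empty F N θ.ν θ.τ9.M _ p.K (k + 1) s hΩ V']; exact one_ne_zero)

/-- **THE LEVEL-(k+1) NO-EXPANSION COHERENCE EQUATION AT THE STAGE-13 RECORD, IN KERNEL**: at `s′` with `Ω_{k+1}(s′) = ∅`, `k < K`, given the §2 identity of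
`ρ_k`'s slot at `init s′` (a witness `(t, E_k)` of `SLaw₁₃ θ p k`, identity branch) and a witness pair `(t′, E_{k+1})` of the (S1ᵀ)₁₃,ₖ dichotomy at `s′`, under
the displayed measurability∕boundedness of the old-branch integrands: EITHER `slotT_{k+1}(s′) ≡ 0` OR, `dV′`-a.e.,
`∫dU δ(ŪV′⁻¹) w(s′)(U,V′)·χ_k(init s′)(U)·𝐓_k(init s′)e^{A_k(init s′)}(U) = Σ_S ∫dU δ(ŪV′⁻¹) ζ0_k(T)·χreg_k(T)·e^{−½quad_k(∅)}·[𝐓_k(init s′,S)e^{A_{k+1}(s′)}_S](U,V′)`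
— «old factors agree» is what makes it true in print ((3.24), Thm 2); here both sides are explicit in the tree's Stage-13 objects, the operands `A_k(init s′)` and
`A_{k+1}(s′)` symbolic. [cite: Balaban1988Convergent, Theorem p.245, (3.1) p.264, (3.24)–(3.25) p.270, (2.18) p.257, (2.21)–(2.23) p.258] -/
theorem tLaw₁₃_coherence_of_Omega_empty {k : ℕ} (hk : k < p.K)
    (s : SeqOfRecord F θ.ν θ.τ9.M (gOfRecord₁₃ F N θ p) p.K (k + 1)) (hΩ : s.Ω (k + 1) = ∅)
    (t : Sect2.TermValues (F.P p.K) (MatA N) (FluctV N) θ.τ9.M) (Ek : ℝ)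
    (hid : ∀ᵐ U₀ ∂fieldMeasure (F.P p.K) k (SU N),
      chiSeqOfRecord F N θ.ν θ.τ9.M (gOfRecord₁₃ F N θ p) p.K k s.init U₀ ≠ 0 →
        slotsOfRecord F N θ.ν θ.τ9 (EOfRecord₁₃ F N θ) (wOfRecord₉ F N θ.toStage9Params) θ.ppSel p
            (gOfRecord₁₃ F N θ p) k s.init U₀ =
          sect2Slot F N (FluctV N) p.K (settingOfRecord₁₃ F N θ p) (θ.Rz p.K) (WtOfRecord₁₃ F N θ p) s.init t Ek
            (UbgOfRecord₁₃ F N θ p k s.init) U₀)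
    (t' : Sect2.TermValues (F.P p.K) (MatA N) (FluctV N) θ.τ9.M) (Ek' : ℝ)
    (hcl : slotsTOfRecord F N θ.ν θ.τ9 (EOfRecord₁₃ F N θ) (wOfRecord₉ F N θ.toStage9Params) θ.ppSel p
          (gOfRecord₁₃ F N θ p) (k + 1) s = 0 ∨
        ∀ᵐ V' ∂fieldMeasure (F.P p.K) (k + 1) (SU N),
          slotsTOfRecord F N θ.ν θ.τ9 (EOfRecord₁₃ F N θ) (wOfRecord₉ F N θ.toStage9Params) θ.ppSel p
              (gOfRecord₁₃ F N θ p) (k + 1) s V' =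
            sect2Slot F N (FluctV N) p.K (settingOfRecord₁₃ F N θ p) (θ.Rz p.K) (WtOfRecord₁₃ F N θ p) s t' Ek'
              (UbgOfRecord₁₃ F N θ p (k + 1) s) V')
    {C : ℝ}
    (hm : ∀ S ∈ admSOfRecord F θ.ν θ.τ9.M (gOfRecord₁₃ F N θ p) p.K k s.init,
      Measurable (Function.uncurry (noExpIntegrandAt F N (FluctV N) p.K k (WtOfRecord₁₃ F N θ p)
        (tkBranchOfRecord F N (FluctV N) θ.ν θ.τ9.M _ p.K (WtOfRecord₁₃ F N θ p) s.init S k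
          (fun ω => sect2Operand F N (FluctV N) p.K (settingOfRecord₁₃ F N θ p) (θ.Rz p.K) s t' Ek' (UbgOfRecord₁₃ F N θ p (k + 1) s)
            (S, fun j => (ω j).2) (fun j => (ω j).1))))))
    (hC : ∀ S ∈ admSOfRecord F θ.ν θ.τ9.M (gOfRecord₁₃ F N θ p) p.K k s.init, ∀ V' U₀,
      |noExpIntegrandAt F N (FluctV N) p.K k (WtOfRecord₁₃ F N θ p)
        (tkBranchOfRecord F N (FluctV N) θ.ν θ.τ9.M _ p.K (WtOfRecord₁₃ F N θ p) s.init S k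
          (fun ω => sect2Operand F N (FluctV N) p.K (settingOfRecord₁₃ F N θ p) (θ.Rz p.K) s t' Ek' (UbgOfRecord₁₃ F N θ p (k + 1) s)
            (S, fun j => (ω j).2) (fun j => (ω j).1)))
        V' U₀| ≤ C) :
    slotsTOfRecord F N θ.ν θ.τ9 (EOfRecord₁₃ F N θ) (wOfRecord₉ F N θ.toStage9Params) θ.ppSel p
        (gOfRecord₁₃ F N θ p) (k + 1) s = 0 ∨
      (fun V' => transportOfRecord F N p.K k (fun U₀ =>
          wOfRecord₉ F N θ.toStage9Params p (gOfRecord₁₃ F N θ p) k s U₀ V' *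
            (chiSeqOfRecord F N θ.ν θ.τ9.M (gOfRecord₁₃ F N θ p) p.K k s.init U₀ *
              sect2Slot F N (FluctV N) p.K (settingOfRecord₁₃ F N θ p) (θ.Rz p.K) (WtOfRecord₁₃ F N θ p) s.init t Ek
                (UbgOfRecord₁₃ F N θ p k s.init) U₀)) V')
        =ᵐ[fieldMeasure (F.P p.K) (k + 1) (SU N)]
      fun V' => ∑ S ∈ admSOfRecord F θ.ν θ.τ9.M (gOfRecord₁₃ F N θ p) p.K k s.init,
        transportOfRecord F N p.K k (noExpIntegrandAt F N (FluctV N) p.K k (WtOfRecord₁₃ F N θ p)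
          (tkBranchOfRecord F N (FluctV N) θ.ν θ.τ9.M _ p.K (WtOfRecord₁₃ F N θ p) s.init S k
            (fun ω => sect2Operand F N (FluctV N) p.K (settingOfRecord₁₃ F N θ p) (θ.Rz p.K) s t' Ek' (UbgOfRecord₁₃ F N θ p (k + 1) s)
              (S, fun j => (ω j).2) (fun j => (ω j).1)))
          V') V' := by
  rcases hcl with h0 | hcl
  · exact Or.inl h0
  · refine Or.inr ?_
    have h1 := transportK_congr_ae_family (avOfRecord_measurable F N p.K k) (avOfRecord_haarAC F N p.K k hk)
      (f := fun V' U₀ => wOfRecord₉ F N θ.toStage9Params p (gOfRecord₁₃ F N θ p) k s U₀ V' *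
        (chiSeqOfRecord F N θ.ν θ.τ9.M (gOfRecord₁₃ F N θ p) p.K k s.init U₀ *
          slotsOfRecord F N θ.ν θ.τ9 (EOfRecord₁₃ F N θ) (wOfRecord₉ F N θ.toStage9Params) θ.ppSel p
            (gOfRecord₁₃ F N θ p) k s.init U₀))
      (g := fun V' U₀ => wOfRecord₉ F N θ.toStage9Params p (gOfRecord₁₃ F N θ p) k s U₀ V' *
        (chiSeqOfRecord F N θ.ν θ.τ9.M (gOfRecord₁₃ F N θ p) p.K k s.init U₀ *
          sect2Slot F N (FluctV N) p.K (settingOfRecord₁₃ F N θ p) (θ.Rz p.K) (WtOfRecord₁₃ F N θ p) s.init t Ek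
            (UbgOfRecord₁₃ F N θ p k s.init) U₀))
      (hid.mono fun U₀ hU V' => by
        by_cases hχ : chiSeqOfRecord F N θ.ν θ.τ9.M (gOfRecord₁₃ F N θ p) p.K k s.init U₀ = 0
        · simp only [hχ, zero_mul, mul_zero]
        · rw [hU hχ])
    have h2 := sect2Slot_succ_ae_eq_sum_transport_of_Omega_empty₁₃ θ p hk s hΩ t' Ek' (UbgOfRecord₁₃ F N θ p (k + 1) s) hm hC
    filter_upwards [hcl, h1, h2] with V' e0 e1 e2
    rw [← e2, ← e0, slotsTOfRecord_succ_apply]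
    exact e1.symm

end LevelSucc

end Literature.MathematicalPhysics.QuantumFieldTheory.Balaban1983to89.Node00

end
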